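import Mathlib
import HarnessLib

/-!
# Crux `BirComplexStableXYR` (stmt-HubbardSuperconductivity-14845): the selector tail bound

Support file (route BalabanIR, line `log-concave-core-bounded-phase`) for the restated engine
`…Theses.BalabanIR.BirComplexStableXYR`.  The Gaussian-smoothed box
`χ_v(u) := ∫_{[-π,π]} g_v(u - t) dt` (`g_v` = Mathlib's `gaussianPDFReal 0 v`) inserted by the
smoothed-box lift pays for far lifts: for `|u| ≥ π` and `t ∈ [-π, π]` one has
`|u - t| ≥ |u| - π ≥ 0`, the centred Gaussian density is even and decreasing in `|x|`, so the
integrand is bounded by `g_v(|u| - π)` on `[-π, π]`, whose volume is `2π`: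

* `lccb_selectorTail` — `χ_v(u) ≤ 2π · g_v(|u| - π)` for `|u| ≥ π`.

[folklore]
-/

noncomputable section

namespace Summit.HubbardSuperconductivity.HubbardSuperconductivity.Theorems

open MeasureTheory

section SelectorTail

/-- The centred Gaussian density is even and decreasing in `|x|`:
`|x| ≤ |y| → g_v(y) ≤ g_v(x)`. [folklore] -/
theorem lccb_gaussianPDFReal_zero_anti {x y : ℝ} (v : NNReal) (h : |x| ≤ |y|) :
    ProbabilityTheory.gaussianPDFReal 0 v y ≤ ProbabilityTheory.gaussianPDFReal 0 v x := by
  simp only [ProbabilityTheory.gaussianPDFReal, sub_zero]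
  refine mul_le_mul_of_nonneg_left (Real.exp_le_exp.2 ?_) (inv_nonneg.2 (Real.sqrt_nonneg _))
  have hv : (0 : ℝ) ≤ 2 * v := by positivity
  have hsq : x ^ 2 ≤ y ^ 2 := by nlinarith [abs_nonneg x, sq_abs x, sq_abs y]
  rw [neg_div, neg_div, neg_le_neg_iff]
  exact div_le_div_of_nonneg_right hsq hv

/-- **Selector tail bound.**  For every variance `v ≠ 0` and every `u` with `π ≤ |u|`,
`∫_{[-π,π]} g_v(u - t) dt ≤ 2π · g_v(|u| - π)`. [folklore] -/
theorem lccb_selectorTail :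
    ∀ (v : NNReal), v ≠ 0 → ∀ u : ℝ, Real.pi ≤ |u| →
    (∫ t in Set.Icc (-Real.pi) Real.pi, ProbabilityTheory.gaussianPDFReal 0 v (u - t)) ≤
      2 * Real.pi * ProbabilityTheory.gaussianPDFReal 0 v (|u| - Real.pi) := by
  intro v _ u hu
  have hπ := Real.pi_pos
  -- pointwise bound on the period cell
  have hbound : ∀ t ∈ Set.Icc (-Real.pi) Real.pi,
      ‖ProbabilityTheory.gaussianPDFReal 0 v (u - t)‖ ≤
        ProbabilityTheory.gaussianPDFReal 0 v (|u| - Real.pi) := by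
    intro t ht
    rw [Real.norm_of_nonneg (ProbabilityTheory.gaussianPDFReal_nonneg _ _ _)]
    apply lccb_gaussianPDFReal_zero_anti
    rw [abs_of_nonneg (by linarith : 0 ≤ |u| - Real.pi)]
    have h1 := abs_sub_abs_le_abs_sub u t
    have ht' : |t| ≤ Real.pi := abs_le.2 ⟨by linarith [ht.1], ht.2⟩
    linarith
  -- integrate over `[-π, π]`, of volume `2π`
  have key := norm_setIntegral_le_of_norm_le_const (measure_Icc_lt_top (μ := volume)) hbound
  rw [Real.volume_real_Icc, max_eq_left (by linarith), sub_neg_eq_add] at key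
  calc (∫ t in Set.Icc (-Real.pi) Real.pi, ProbabilityTheory.gaussianPDFReal 0 v (u - t))
      ≤ ‖∫ t in Set.Icc (-Real.pi) Real.pi, ProbabilityTheory.gaussianPDFReal 0 v (u - t)‖ :=
        Real.le_norm_self _
    _ ≤ ProbabilityTheory.gaussianPDFReal 0 v (|u| - Real.pi) * (Real.pi + Real.pi) := key
    _ = 2 * Real.pi * ProbabilityTheory.gaussianPDFReal 0 v (|u| - Real.pi) := by ring

end SelectorTail

end Summit.HubbardSuperconductivity.HubbardSuperconductivity.Theorems
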